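import Summits.ResolutionOfSingularities.ResolutionOfSingularities.Theorems.HilbertSamuelEliminationSigmaMaxModificationsCorridor3SigmaBoundaryCompactnessStates
import HarnessLib

/-!
# [OURS · L1 W4.2] σE-COMPACTNESS, part 2/2: an infinite functional boundary-threaded σ-run from a good state carries an infinite chain of
# CLOSED marked σE-near points starting at some closed point of `X(ν)` (König over the proper exceptional towers)
# (the σE-port of `…CampaignW42TertiaryCompactnessGeneral.lean`; cell res-hironaka, LADDER-RESOLUTION rung L; slot W4.2, crux chain w42
# `SigmaMaxModificationsCorridor3` stmt-ResolutionOfSingularities-19249 / crux stmt-…-18506; res-L1-w42-plan-1 RULING v3.14-13 (CW)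
# «(E5) σE-COMPACTNESS» 2026-08-27T10:52:00Z; hand res-D-pv-047 AS res-L1-s46-pv-10; `--supports stmt-ResolutionOfSingularities-19249 --as helper`)

HONEST FRAMING. OURS proof architecture; NOTHING is a statement of H. Hironaka's manuscript [Hironaka2017] nor of Cossart–Jannsen–Saito;
no named fact is introduced. AI-written; AI review is weaker than expert review.

WHAT IS PORTED (verbatim arguments of res-L1-s42-pv-2's `…CampaignW42TertiaryCompactnessGeneral.lean` — the CJS step replaced by a step of
a FUNCTIONAL boundary-aware strategy `σ : StrategyE` that steps only while the `ν`-stratum is non-empty; states, runs, good states from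
part 1/2 `…Corridor3SigmaBoundaryCompactnessStates.lean`):

* `exists_canonicalNearStepσE_of_persistent` — THE SUCCESSOR STEP: from a marked E-stage whose marked point is CLOSED and PERSISTENT
  (every σE-run from its state has a stratum point over it), in a good state from which σE-runs of every length exist, there is a σE-near
  step (o1's `CanonicalNearStepσE`) to a marked E-stage of the same kind. The sets `A_m` of points of the blow-up over the marked point
  carrying a depth-`m` stratum point are closed (proper images of closed strata), non-empty, decreasing; they stabilise (Noetherian stage)
  and a CLOSED point of their intersection (quasi-compact stage) is the next marked point.
* `exists_persistent_closedPt_σE` — THE INITIAL POINT: if the σE-runs from a good initial state go on for ever, SOME CLOSED `x₀ ∈ X(ν)` is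
  persistent (the images of the depth-`m` strata are closed, non-empty, decreasing, stabilise).
* **`exists_nearChainσE_of_runInfiniteσE`** — THE CHAIN (dependent choice): the (α) statement of RULING v3.14-13 (CW).
* `not_runInfiniteσE_of_forall_noNearChainσE` — contrapositive: if NO closed point of `X(ν)` starts an infinite σE-near chain, the σE-runs
  from `X` do not go on for ever. (With a totality dichotomy the caller concludes termination; the maximal-origin packaging
  `IsMaximalOrigin p N ν X x` of the chain's start is assembled by the caller from the datum's own hypotheses.)

## References (context)

* V. Cossart, U. Jannsen, S. Saito, LNM 2270 (2020), Rem. 6.29 (1), p. 98 Step 9, p. 105, p. 107. [CossartJannsenSaito2020]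
-/

noncomputable section

set_option linter.dupNamespace false -- mandated namespace of this single-conjunct summit

open CategoryTheory AlgebraicGeometry TopologicalSpace Topology
open Summit.ResolutionOfSingularities.ResolutionOfSingularities.Theorems.CampaignW42
open Literature.AlgebraicGeometry.Resolution Literature.RingTheory.HilbertSamuel
open Literature.AlgebraicGeometry.CossartJannsenSaito2020

namespace Summit.ResolutionOfSingularities.ResolutionOfSingularities.Theorems.SigmaMaxModificationsCorridor3.Sigma

universe u

variable {σ : StrategyE.{u}} {N : ℕ} {ν : ℕ → ℕ}
variable {k : Type u} [Field k]

/-! ## The successor step -/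

/-- **THE SUCCESSOR STEP.** From a marked E-stage `s` whose marked point is CLOSED and PERSISTENT (every σE-run from the state of `s` has a
stratum point over it), in a good state from which σ (functional, stepping only while the stratum is non-empty) has runs of every length,
there is a σE-near step to a marked E-stage of the same kind. [cite: CossartJannsenSaito2020, p. 105] -/
theorem exists_canonicalNearStepσE_of_persistent (hσ : σ.IsFunctional N ν) {s : MarkedStageE.{u}}
    (hcl : IsClosed ({s.pt} : Set s.W)) (hgood : StateGoodσE k σ N ν s.W s.ln s.L s.P s.E)
    (hinf : ∀ m, ∃ t : CentreSeq s.W, IsRunFromσE σ N ν s.ln s.L s.P s.E t ∧ t.length = m)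
    (hpers : ∀ t : CentreSeq s.W, IsRunFromσE σ N ν s.ln s.L s.P s.E t →
      ∃ z : t.top, z ∈ Scheme.hsStratum t.top N ν ∧ t.comp.base z = s.pt) :
    ∃ s' : MarkedStageE.{u}, CanonicalNearStepσE σ N ν s s' ∧ IsClosed ({s'.pt} : Set s'.W) ∧
      StateGoodσE k σ N ν s'.W s'.ln s'.L s'.P s'.E ∧
      (∀ m, ∃ t : CentreSeq s'.W, IsRunFromσE σ N ν s'.ln s'.L s'.P s'.E t ∧ t.length = m) ∧
      ∀ t : CentreSeq s'.W, IsRunFromσE σ N ν s'.ln s'.L s'.P s'.E t →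
        ∃ z : t.top, z ∈ Scheme.hsStratum t.top N ν ∧ t.comp.base z = s'.pt := by
  haveI : IsLocallyNoetherian s.W := s.ln
  -- the step σ allows from `s`
  obtain ⟨t₁, ht₁, hlen₁⟩ := hinf 1
  obtain ⟨C, rest₁, rfl⟩ : ∃ (C : s.W.IdealSheafData) (rest : CentreSeq (blowup C)),
      t₁ = CentreSeq.cons C rest := by
    cases t₁ with
    | nil _ => simp at hlen₁
    | cons C rest => exact ⟨C, rest, rfl⟩
  obtain ⟨P', hst, -⟩ := ht₁
  have hgood' : StateGoodσE k σ N ν (blowup C) (isLocallyNoetherian_blowup s.ln C)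
      (s.L.next (Scheme.hsStratum s.W N ν) C) P' (s.E.next C) := hgood.next hst
  haveI : IsLocallyNoetherian (blowup C) := isLocallyNoetherian_blowup s.ln C
  haveI : IsNoetherian (blowup C) := hgood'.isNoetherian
  -- runs from the next state
  have hinf' : ∀ m, ∃ r : CentreSeq (blowup C),
      IsRunFromσE σ N ν (isLocallyNoetherian_blowup s.ln C) (s.L.next (Scheme.hsStratum s.W N ν) C) P' (s.E.next C) r ∧
        r.length = m := by
    intro m
    obtain ⟨t, ht, hlen⟩ := hinf (m + 1)
    obtain ⟨rest, rfl, hrest, hrlen⟩ := exists_eq_cons_of_runσE hσ hst ht hlen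
    exact ⟨rest, hrest, hrlen⟩
  choose r hr hrlen using hinf'
  -- the sets `A m`
  let A : ℕ → Set ↥(blowup C) := fun m =>
    {y' | (blowup.π C).base y' = s.pt ∧
      ∃ z : (r m).top, z ∈ Scheme.hsStratum (r m).top N ν ∧ (r m).comp.base z = y'}
  have hruniq : ∀ {m} (t : CentreSeq (blowup C)),
      IsRunFromσE σ N ν (isLocallyNoetherian_blowup s.ln C) (s.L.next (Scheme.hsStratum s.W N ν) C) P' (s.E.next C) t →
        t.length = m → t = r m :=
    fun t ht hlen => IsRunFromσE.eq_of_length_eq hσ _ _ _ _ ht (hr _) (hlen.trans (hrlen _).symm)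
  have hAclosed : ∀ m, IsClosed (A m) := by
    intro m
    obtain ⟨hW'', L'', P''', E'', hgtop⟩ := exists_stateGoodσE_top_of_runσE m hgood' (r m) (hr m) (hrlen m)
    have h1 : IsClosed ((fun y' : ↥(blowup C) => (blowup.π C).base y') ⁻¹' {s.pt}) :=
      hcl.preimage (blowup.π C).continuous
    haveI : IsProper (r m).comp := CentreSeq.isProper_comp (r m)
    have h2 : IsClosed ((fun z : ↥((r m).top) => (r m).comp.base z) '' Scheme.hsStratum (r m).top N ν) :=
      (r m).comp.isClosedMap _ hgtop.isClosed_hsStratum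
    have hA : A m = ((fun y' : ↥(blowup C) => (blowup.π C).base y') ⁻¹' {s.pt}) ∩
        ((fun z : ↥((r m).top) => (r m).comp.base z) '' Scheme.hsStratum (r m).top N ν) := by
      ext y'
      simp only [A, Set.mem_setOf_eq, Set.mem_inter_iff, Set.mem_preimage, Set.mem_singleton_iff, Set.mem_image]
    rw [hA]
    exact h1.inter h2
  have hAne : ∀ m, (A m).Nonempty := by
    intro m
    obtain ⟨z, hz, hzeq⟩ := hpers (CentreSeq.cons C (r m)) ⟨P', hst, hr m⟩
    exact ⟨(r m).comp.base z, hzeq, z, hz, rfl⟩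
  have hAanti : ∀ m, A (m + 1) ⊆ A m := by
    intro m y' hy'
    obtain ⟨hπ, z', hz', hzeq'⟩ := hy'
    obtain ⟨t, ht, htlen, z, hz, hzeq⟩ :=
      exists_runσE_pred_of_runσE_succ m hgood' (r (m + 1)) (hr _) (hrlen _) z' hz'
    obtain rfl : t = r m := hruniq t ht htlen
    exact ⟨hπ, z, hz, hzeq.trans hzeq'⟩
  have hAanti' : Antitone A := antitone_nat_of_succ_le hAanti
  obtain ⟨M, hM⟩ : ∃ M, ∀ m, M ≤ m → A m = A M := by
    let F : ℕ → Closeds ↥(blowup C) := fun m => ⟨A m, hAclosed m⟩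
    obtain ⟨B, ⟨M, rfl⟩, hmin⟩ :=
      (wellFounded_lt (α := Closeds ↥(blowup C))).has_min (Set.range F) ⟨F 0, 0, rfl⟩
    refine ⟨M, fun m hm => ?_⟩
    have hle : F m ≤ F M := hAanti' hm
    have hnlt : ¬ F m < F M := hmin (F m) ⟨m, rfl⟩
    have heq : F m = F M := hle.eq_or_lt.resolve_right hnlt
    exact congrArg (fun B : Closeds ↥(blowup C) => (B : Set ↥(blowup C))) heq
  haveI : CompactSpace ↥(blowup C) := inferInstance
  obtain ⟨y', hy'M, hy'cl⟩ := (hAclosed M).exists_closed_singleton (hAne M)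
  have hy' : ∀ m, y' ∈ A m := by
    intro m
    rcases le_total M m with hm | hm
    · rw [hM m hm]; exact hy'M
    · exact hAanti' hm hy'M
  obtain ⟨hπy', z₀, hz₀, hz₀eq⟩ := hy' 0
  have hr0 : r 0 = CentreSeq.nil _ := by
    have := hrlen 0
    cases h : r 0 with
    | nil _ => rfl
    | cons _ _ => rw [h] at this; simp at this
  have hy'str : y' ∈ Scheme.hsStratum (blowup C) N ν := by
    have key : ∀ (t : CentreSeq (blowup C)) (ht : t = CentreSeq.nil _) (z : t.top),
        z ∈ Scheme.hsStratum t.top N ν → t.comp.base z = y' → y' ∈ Scheme.hsStratum (blowup C) N ν := by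
      intro t ht z hz hzeq
      subst ht
      simpa using (show (CentreSeq.nil (blowup C)).comp.base z = y' from hzeq) ▸ hz
    exact key (r 0) hr0 z₀ hz₀ hz₀eq
  refine ⟨⟨⟨blowup C, isLocallyNoetherian_blowup s.ln C, s.L.next (Scheme.hsStratum s.W N ν) C, P', y'⟩, s.E.next C⟩,
    ⟨C, P', isLocallyNoetherian_blowup s.ln C, y', hst, hπy', hy'cl, hy'str, rfl⟩, hy'cl, hgood',
    fun m => ⟨r m, hr m, hrlen m⟩, fun t ht => ?_⟩
  have ht' : t = r t.length := hruniq t ht rfl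
  obtain ⟨-, z, hz, hzeq⟩ := hy' t.length
  rw [ht']
  exact ⟨z, hz, hzeq⟩

/-! ## The initial point -/

/-- **THE INITIAL POINT.** If σ (functional, stepping only while the stratum is non-empty) has boundary-threaded runs of every length from a
good initial state of `X` with boundary `E₀`, some CLOSED point `x₀ ∈ X(ν)` is PERSISTENT: every σE-run from the initial state has a stratum
point over `x₀`. [cite: CossartJannsenSaito2020, p. 105, p. 107] -/
theorem exists_persistent_closedPt_σE (hσ : σ.IsFunctional N ν) (hne : σ.StepsOnlyWhileNonempty N ν) {X : Scheme.{u}}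
    [hX : IsLocallyNoetherian X] {E₀ : Boundary X} (hgood : StateGoodσE k σ N ν X hX (Labelling.init X) none E₀)
    (hinf : RunInfiniteσE σ N ν X E₀) :
    ∃ x : X, x ∈ Scheme.hsStratum X N ν ∧ IsClosed ({x} : Set X) ∧
      ∀ t : CentreSeq X, IsRunσE σ N ν E₀ t →
        ∃ z : t.top, z ∈ Scheme.hsStratum t.top N ν ∧ t.comp.base z = x := by
  haveI : IsNoetherian X := hgood.isNoetherian
  choose r hr hrlen using hinf
  have hruniq : ∀ {m} (t : CentreSeq X), IsRunσE σ N ν E₀ t → t.length = m → t = r m :=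
    fun t ht hlen => IsRunFromσE.eq_of_length_eq hσ _ _ _ _ ht (hr _) (hlen.trans (hrlen _).symm)
  let B : ℕ → Set X := fun m =>
    {y | ∃ z : (r m).top, z ∈ Scheme.hsStratum (r m).top N ν ∧ (r m).comp.base z = y}
  have hBclosed : ∀ m, IsClosed (B m) := by
    intro m
    obtain ⟨hW'', L'', P''', E'', hgtop⟩ := exists_stateGoodσE_top_of_runσE m hgood (r m) (hr m) (hrlen m)
    haveI : IsProper (r m).comp := CentreSeq.isProper_comp (r m)
    have h2 : IsClosed ((fun z : ↥((r m).top) => (r m).comp.base z) '' Scheme.hsStratum (r m).top N ν) :=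
      (r m).comp.isClosedMap _ hgtop.isClosed_hsStratum
    have hB : B m = (fun z : ↥((r m).top) => (r m).comp.base z) '' Scheme.hsStratum (r m).top N ν := by
      ext y
      simp only [B, Set.mem_setOf_eq, Set.mem_image]
    rw [hB]
    exact h2
  have hBne : ∀ m, (B m).Nonempty := by
    intro m
    obtain ⟨z, hz⟩ := hsStratum_top_nonempty_of_runsσE hσ hne m _ _ _ _ (r m) (hr m) (hrlen m) ⟨r (m + 1), hr _, hrlen _⟩
    exact ⟨(r m).comp.base z, z, hz, rfl⟩
  have hBanti : ∀ m, B (m + 1) ⊆ B m := by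
    intro m y hy
    obtain ⟨z', hz', hzeq'⟩ := hy
    obtain ⟨t, ht, htlen, z, hz, hzeq⟩ := exists_runσE_pred_of_runσE_succ m hgood (r (m + 1)) (hr _) (hrlen _) z' hz'
    obtain rfl : t = r m := hruniq t ht htlen
    exact ⟨z, hz, hzeq.trans hzeq'⟩
  have hBanti' : Antitone B := antitone_nat_of_succ_le hBanti
  obtain ⟨M, hM⟩ : ∃ M, ∀ m, M ≤ m → B m = B M := by
    let F : ℕ → Closeds X := fun m => ⟨B m, hBclosed m⟩
    obtain ⟨B', ⟨M, rfl⟩, hmin⟩ := (wellFounded_lt (α := Closeds X)).has_min (Set.range F) ⟨F 0, 0, rfl⟩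
    refine ⟨M, fun m hm => ?_⟩
    have hle : F m ≤ F M := hBanti' hm
    have hnlt : ¬ F m < F M := hmin (F m) ⟨m, rfl⟩
    have heq : F m = F M := hle.eq_or_lt.resolve_right hnlt
    exact congrArg (fun B : Closeds X => (B : Set X)) heq
  haveI : CompactSpace X := inferInstance
  obtain ⟨x, hxM, hxcl⟩ := (hBclosed M).exists_closed_singleton (hBne M)
  have hx : ∀ m, x ∈ B m := by
    intro m
    rcases le_total M m with hm | hm
    · rw [hM m hm]; exact hxM
    · exact hBanti' hm hxM
  have hr0 : r 0 = CentreSeq.nil _ := by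
    have := hrlen 0
    cases h : r 0 with
    | nil _ => rfl
    | cons _ _ => rw [h] at this; simp at this
  have hxstr : x ∈ Scheme.hsStratum X N ν := by
    obtain ⟨z₀, hz₀, hz₀eq⟩ := hx 0
    have key : ∀ (t : CentreSeq X) (ht : t = CentreSeq.nil _) (z : t.top),
        z ∈ Scheme.hsStratum t.top N ν → t.comp.base z = x → x ∈ Scheme.hsStratum X N ν := by
      intro t ht z hz hzeq
      subst ht
      simpa using (show (CentreSeq.nil X).comp.base z = x from hzeq) ▸ hz
    exact key (r 0) hr0 z₀ hz₀ hz₀eq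
  refine ⟨x, hxstr, hxcl, fun t ht => ?_⟩
  have ht' : t = r t.length := hruniq t ht rfl
  obtain ⟨z, hz, hzeq⟩ := hx t.length
  rw [ht']
  exact ⟨z, hz, hzeq⟩

/-! ## The chain -/

/-- **(α) AN INFINITE FUNCTIONAL σE-RUN CARRIES AN INFINITE CHAIN OF CLOSED MARKED σE-NEAR POINTS FROM SOME CLOSED POINT OF `X(ν)`**
(good initial state with boundary `E₀`; σ steps only while the stratum is non-empty). [cite: CossartJannsenSaito2020, p. 105, p. 107] -/
theorem exists_nearChainσE_of_runInfiniteσE (hσ : σ.IsFunctional N ν) (hne : σ.StepsOnlyWhileNonempty N ν) {X : Scheme.{u}}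
    [hX : IsLocallyNoetherian X] (E₀ : Boundary X) (hgood : StateGoodσE k σ N ν X hX (Labelling.init X) none E₀)
    (hinf : RunInfiniteσE σ N ν X E₀) :
    ∃ (x : X) (c : ℕ → MarkedStageE.{u}), x ∈ Scheme.hsStratum X N ν ∧ IsClosed ({x} : Set X) ∧
      c 0 = MarkedStageE.init X x E₀ ∧ ∀ n, CanonicalNearStepσE σ N ν (c n) (c (n + 1)) := by
  obtain ⟨x, hxstr, hxcl, hpers⟩ := exists_persistent_closedPt_σE hσ hne hgood hinf
  let G : MarkedStageE.{u} → Prop := fun s =>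
    IsClosed ({s.pt} : Set s.W) ∧ StateGoodσE k σ N ν s.W s.ln s.L s.P s.E ∧
      (∀ m, ∃ t : CentreSeq s.W, IsRunFromσE σ N ν s.ln s.L s.P s.E t ∧ t.length = m) ∧
      ∀ t : CentreSeq s.W, IsRunFromσE σ N ν s.ln s.L s.P s.E t →
        ∃ z : t.top, z ∈ Scheme.hsStratum t.top N ν ∧ t.comp.base z = s.pt
  have h0 : G (MarkedStageE.init X x E₀) := ⟨hxcl, hgood, hinf, hpers⟩
  have hsucc : ∀ s : {s : MarkedStageE.{u} // G s}, ∃ s' : {s : MarkedStageE.{u} // G s},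
      CanonicalNearStepσE σ N ν s.1 s'.1 := by
    rintro ⟨s, hcl, hg, hi, hp⟩
    obtain ⟨s', hss', hcl', hg', hi', hp'⟩ := exists_canonicalNearStepσE_of_persistent hσ hcl hg hi hp
    exact ⟨⟨s', hcl', hg', hi', hp'⟩, hss'⟩
  choose g hg using hsucc
  let c : ℕ → {s : MarkedStageE.{u} // G s} := fun n => Nat.rec ⟨MarkedStageE.init X x E₀, h0⟩ (fun _ s => g s) n
  exact ⟨x, fun n => (c n).1, hxstr, hxcl, rfl, fun n => hg (c n)⟩

/-- **NO CLOSED POINT OF `X(ν)` STARTS AN INFINITE σE-NEAR CHAIN ⇒ THE σE-RUNS DO NOT GO ON FOR EVER** (good initial state; σ functional,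
stepping only while the stratum is non-empty). [cite: CossartJannsenSaito2020, p. 107] -/
theorem not_runInfiniteσE_of_forall_noNearChainσE (hσ : σ.IsFunctional N ν) (hne : σ.StepsOnlyWhileNonempty N ν)
    {X : Scheme.{u}} [hX : IsLocallyNoetherian X] (E₀ : Boundary X)
    (hgood : StateGoodσE k σ N ν X hX (Labelling.init X) none E₀)
    (hno : ∀ x : X, x ∈ Scheme.hsStratum X N ν → IsClosed ({x} : Set X) →
      ¬ ∃ c : ℕ → MarkedStageE.{u}, c 0 = MarkedStageE.init X x E₀ ∧ ∀ n, CanonicalNearStepσE σ N ν (c n) (c (n + 1))) :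
    ¬ RunInfiniteσE σ N ν X E₀ := by
  intro hinf
  obtain ⟨x, c, hxstr, hxcl, h0, hc⟩ := exists_nearChainσE_of_runInfiniteσE hσ hne E₀ hgood hinf
  exact hno x hxstr hxcl ⟨c, h0, hc⟩

end Summit.ResolutionOfSingularities.ResolutionOfSingularities.Theorems.SigmaMaxModificationsCorridor3.Sigma

end
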